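import Mathlib
import Literature.AlgebraicGeometry.Resolution.CobordantGame
import Summits.ResolutionOfSingularities.ResolutionOfSingularities.Theorems.WeightedInvariantLocalWeightedDropGradedGameRelabel
import Summits.ResolutionOfSingularities.ResolutionOfSingularities.Theorems.WeightedInvariantLocalWeightedDropGradedSliceWildRankZero

/-!
# `WeightedInvariant.LocalWeightedDrop`: the slice theorems AT ANY FROZEN COORDINATE (general slot)

Route `ResolutionOfSingularities/WeightedInvariant`, crux `LocalWeightedDrop` (stmt-ResolutionOfSingularities-8899).
[OURS · L1 W4.3] — res-type-099 (gen 13), consumer of the relabelling module `…GradedGameRelabel` (p530770): the slice theorems of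
the graded-slice line (ideator res-L1-w43-idea-1; res-type-060 p515424 tame, res-type-099 p529887 rank-`0` wild) are stated with the
frozen coordinate LAST; here they are transported to an ARBITRARY frozen coordinate `i₀` by the swap `i₀ ↔ last` (the permutation
`toLast i₀`, its lift `liftPerm`, and the induced permutation `slicePerm i₀` of the slice variables).  So card A's induction may freeze
a translated coordinate of MINIMAL `p`-adic weight valuation wherever it sits.  Nothing here is a statement of the manuscript under
review on ladder RESOLUTION; bookkeeping only.  AI proof, weaker than expert review.

* §1 `toLast`, `slicePerm` and `castSucc_slicePerm` (`castSucc (slicePerm i₀ j) = (liftPerm (toLast i₀)) (i₀.succ.succAbove j)`);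
* §2 `sliceGerm_last_relabel` (the slice at `last` of the relabelled successor is the relabelled slice at `i₀`), `sliceLattice_permLattice`
  (same for lattices), `subst_cruxChart_relabel_toLast` (the factorisation `F'(chart_c) = sᵃ g` relabels);
* §3 **`gradedWonBy_of_slice_tame_at`**, **`gradedWonBy_zero_of_slice_wild_at`** — p515424 and p529887 at any frozen coordinate `i₀`.
-/

set_option linter.dupNamespace false -- mandated namespace of this single-conjunct summit
set_option autoImplicit false

namespace Summit.ResolutionOfSingularities.ResolutionOfSingularities.Theorems

namespace GradedGame

open MvPowerSeries
open Literature.AlgebraicGeometry.Resolution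

variable {k : Type} [Field k]

/-! ## §1 Moving the frozen coordinate to the last slot -/

section Perms

variable {n : ℕ} (i₀ : Fin (n + 1))

/-- The swap `i₀ ↔ last` of the coordinates of `F'`. [OURS · L1 W4.3] -/
def toLast : Equiv.Perm (Fin (n + 1)) := Equiv.swap i₀ (Fin.last n)

/-- `toLast i₀ i₀ = last`. [OURS · L1 W4.3] -/
theorem toLast_self : toLast i₀ i₀ = Fin.last n := by simp [toLast]

/-- `(toLast i₀)⁻¹ last = i₀`. [OURS · L1 W4.3] -/
theorem toLast_symm_last : (toLast i₀).symm (Fin.last n) = i₀ := by simp [toLast, Equiv.swap_apply_right]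

/-- The lift moves `y_{i₀}` to the last slot of the successor variables. [OURS · L1 W4.3] -/
theorem liftPerm_toLast_succ : liftPerm (toLast i₀) i₀.succ = Fin.last (n + 1) := by
  rw [liftPerm_succ, toLast_self, Fin.succ_last]

/-- `x ≠ y_{i₀}` iff its image is not the last slot. [OURS · L1 W4.3] -/
theorem ne_succ_iff_liftPerm_ne_last (x : Fin (n + 1 + 1)) : x ≠ i₀.succ ↔ liftPerm (toLast i₀) x ≠ Fin.last (n + 1) := by
  rw [← liftPerm_toLast_succ i₀]
  exact (Equiv.apply_eq_iff_eq _).not.symm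

/-- THE INDUCED PERMUTATION OF THE SLICE VARIABLES: slice variables at `i₀` (indexed through `i₀.succ.succAbove`) ↦ slice variables at
`last` (indexed through `castSucc`), along the lift of `toLast i₀`. [OURS · L1 W4.3] -/
noncomputable def slicePerm : Equiv.Perm (Fin (n + 1)) :=
  (finSuccAboveEquiv i₀.succ).trans (((liftPerm (toLast i₀)).subtypeEquiv (ne_succ_iff_liftPerm_ne_last i₀)).trans
    (finSuccAboveEquiv (Fin.last (n + 1))).symm)

/-- Defining property of `slicePerm`. [OURS · L1 W4.3] -/
theorem castSucc_slicePerm (j : Fin (n + 1)) :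
    Fin.castSucc (slicePerm i₀ j) = liftPerm (toLast i₀) (i₀.succ.succAbove j) := by
  unfold slicePerm
  simp only [Equiv.trans_apply, finSuccAboveEquiv_apply, Equiv.subtypeEquiv_apply, finSuccAboveEquiv_symm_apply_last]
  ext; simp

end Perms

/-! ## §2 Transport of slices, slice lattices and the factorisation -/

section Transport

variable {n : ℕ} (i₀ : Fin (n + 1))

/-- **THE SLICE AT `last` OF THE RELABELLED SUCCESSOR IS THE RELABELLED SLICE AT `i₀`.** [OURS · L1 W4.3] -/
theorem sliceGerm_last_relabel (g : MvPowerSeries (Fin (n + 1 + 1)) k) :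
    sliceGerm (Fin.last n) (relabel (liftPerm (toLast i₀)) g) = relabel (slicePerm i₀) (sliceGerm i₀ g) := by
  classical
  ext e
  rw [coeff_sliceGerm, coeff_relabel, coeff_relabel, coeff_sliceGerm]
  suffices hE : Finsupp.equivMapDomain (liftPerm (toLast i₀)).symm
      (e.embDomain ⟨(Fin.last n).succ.succAbove, Fin.succAbove_right_injective⟩) =
      (Finsupp.equivMapDomain (slicePerm i₀).symm e).embDomain ⟨i₀.succ.succAbove, Fin.succAbove_right_injective⟩ by
    rw [hE]
  ext x
  rw [Finsupp.equivMapDomain_apply, Equiv.symm_symm]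
  by_cases hx : x = i₀.succ
  · subst hx
    rw [Finsupp.embDomain_notin_range, Finsupp.embDomain_notin_range]
    · rintro ⟨j, hj⟩; exact Fin.succAbove_ne _ j hj
    · rintro ⟨j, hj⟩
      simp only [Function.Embedding.coeFn_mk] at hj
      rw [Fin.succ_last, Fin.succAbove_last, liftPerm_toLast_succ] at hj
      exact (Fin.castSucc_lt_last j).ne hj
  · obtain ⟨j, rfl⟩ := Fin.exists_succAbove_eq hx
    have hR : i₀.succ.succAbove j = (⟨i₀.succ.succAbove, Fin.succAbove_right_injective⟩ : Fin (n + 1) ↪ Fin (n + 1 + 1)) j := rfl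
    have h1 : (liftPerm (toLast i₀)) (i₀.succ.succAbove j) = (⟨(Fin.last n).succ.succAbove, Fin.succAbove_right_injective⟩ :
        Fin (n + 1) ↪ Fin (n + 1 + 1)) (slicePerm i₀ j) := by
      simp only [Function.Embedding.coeFn_mk]
      rw [Fin.succ_last, Fin.succAbove_last, castSucc_slicePerm]
    rw [h1, Finsupp.embDomain_apply_self]
    conv_rhs => rw [hR]
    rw [Finsupp.embDomain_apply_self, Finsupp.equivMapDomain_apply, Equiv.symm_symm]

/-- **THE SLICE LATTICE AT `last` OF THE RELABELLED LATTICE IS THE RELABELLED SLICE LATTICE AT `i₀`.** [OURS · L1 W4.3] -/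
theorem sliceLattice_permLattice (L' : AddSubgroup (Fin (n + 1 + 1) → ℤ)) :
    sliceLattice (permLattice (liftPerm (toLast i₀)) L') (Fin.last n) = permLattice (slicePerm i₀) (sliceLattice L' i₀) := by
  ext u
  rw [mem_sliceLattice_iff, mem_permLattice_iff, mem_sliceLattice_iff]
  constructor
  · rintro ⟨v, hv, rfl⟩
    rw [mem_permLattice_iff] at hv
    refine ⟨_, hv, ?_⟩
    funext j
    simp only
    rw [← castSucc_slicePerm, Fin.succ_last, Fin.succAbove_last]
  · rintro ⟨v', hv', huv⟩
    refine ⟨fun x => v' ((liftPerm (toLast i₀)).symm x), ?_, ?_⟩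
    · rw [mem_permLattice_iff]
      simpa using hv'
    · funext j'
      obtain ⟨j, rfl⟩ := (slicePerm i₀).surjective j'
      have := congrFun huv j
      simp only at this ⊢
      rw [Fin.succ_last, Fin.succAbove_last, castSucc_slicePerm, Equiv.symm_apply_apply, this]

/-- The factorisation `F'(chart_c) = sᵃ·g` relabels (swap `i₀ ↔ last` downstairs, its lift upstairs). [OURS · L1 W4.3] -/
theorem subst_cruxChart_relabel_toLast (w : Fin (n + 1) → ℕ) (c : Fin (n + 1) → k) (F' : MvPowerSeries (Fin (n + 1)) k) (a : ℕ)
    (g : MvPowerSeries (Fin (n + 1 + 1)) k) (hfac : subst (CobordantGame.cruxChart k w c) F' = X 0 ^ a * g) :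
    subst (CobordantGame.cruxChart k (fun j => w ((toLast i₀).symm j)) (fun j => c ((toLast i₀).symm j))) (relabel (toLast i₀) F') =
      X 0 ^ a * relabel (liftPerm (toLast i₀)) g := by
  rw [subst_cruxChart_relabel]
  have hc : (fun j => (fun j => c ((toLast i₀).symm j)) ((toLast i₀) j)) = c := by funext j; simp
  rw [hc, hfac]
  unfold relabel
  rw [subst_mul (hasSubst_relabelFamily _), subst_pow (hasSubst_relabelFamily _), subst_X (hasSubst_relabelFamily _), liftPerm_zero]

/-- The propagated lattice relabels. [OURS · L1 W4.3] -/
theorem succLattice_relabel_toLast (L : AddSubgroup (Fin (n + 1) → ℤ)) (w : Fin (n + 1) → ℕ) (c : Fin (n + 1) → k) :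
    succLattice (permLattice (toLast i₀) L) (fun j => w ((toLast i₀).symm j)) (fun j => c ((toLast i₀).symm j)) =
      permLattice (liftPerm (toLast i₀)) (succLattice L w c) := by
  rw [succLattice_permLattice]
  congr 2
  funext j; simp

end Transport

/-! ## §3 The slice theorems at any frozen coordinate -/

section AnySlot

variable {n : ℕ} (i₀ : Fin (n + 1)) (w : Fin (n + 1) → ℕ) (c : Fin (n + 1) → k)

/-- **THE TAME SLICE THEOREM AT ANY FROZEN COORDINATE** (res-type-060's `gradedWonBy_of_slice_tame`, p515424, transported by the swap
`i₀ ↔ last`). [OURS · L1 W4.3] -/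
theorem gradedWonBy_of_slice_tame_at (α : Ordinal.{0}) (L : AddSubgroup (Fin (n + 1) → ℤ)) (F' : MvPowerSeries (Fin (n + 1)) k)
    (a : ℕ) (g : MvPowerSeries (Fin (n + 1 + 1)) k) (hfac : subst (CobordantGame.cruxChart k w c) F' = X 0 ^ a * g)
    (hc : c i₀ ≠ 0) (hw : 0 < w i₀) (htame : ((w i₀ : ℕ) : k) ≠ 0) :
    GradedWonBy α (n + 1) (sliceLattice (succLattice L w c) i₀) (sliceGerm i₀ g) → GradedWonBy α (n + 1 + 1) (succLattice L w c) g := by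
  intro hh
  have hfac' := subst_cruxChart_relabel_toLast i₀ w c F' a g hfac
  have h1 : GradedWonBy α (n + 1) (sliceLattice (succLattice (permLattice (toLast i₀) L) (fun j => w ((toLast i₀).symm j))
      (fun j => c ((toLast i₀).symm j))) (Fin.last n)) (sliceGerm (Fin.last n) (relabel (liftPerm (toLast i₀)) g)) := by
    rw [succLattice_relabel_toLast, sliceLattice_permLattice, sliceGerm_last_relabel, gradedWonBy_relabel_iff]
    exact hh
  have h2 := gradedWonBy_of_slice_tame (fun j => w ((toLast i₀).symm j)) (fun j => c ((toLast i₀).symm j)) α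
    (permLattice (toLast i₀) L) (relabel (toLast i₀) F') a _ hfac' (by simpa [toLast_symm_last] using hc)
    (by simpa [toLast_symm_last] using hw) (by simpa [toLast_symm_last] using htame) h1
  rw [succLattice_relabel_toLast, gradedWonBy_relabel_iff] at h2
  exact h2

/-- **THE RANK-`0` WILD SLICE THEOREM AT ANY FROZEN COORDINATE OF MINIMAL VALUATION** (`gradedWonBy_zero_of_slice_wild`, p529887,
transported by the swap `i₀ ↔ last`). [OURS · L1 W4.3] -/
theorem gradedWonBy_zero_of_slice_wild_at (q : ℕ) (L : AddSubgroup (Fin (n + 1) → ℤ)) (F' : MvPowerSeries (Fin (n + 1)) k) (a : ℕ)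
    (g : MvPowerSeries (Fin (n + 1 + 1)) k) (hfac : subst (CobordantGame.cruxChart k w c) F' = X 0 ^ a * g)
    (hc : c i₀ ≠ 0) (hw : 0 < w i₀) (p e : ℕ) [Fact p.Prime] [CharP k p] (hq : q = p ^ e)
    (hv : q ∣ w i₀) (hE : ((w i₀ / q : ℕ) : k) ≠ 0) (hmin : ∀ j, j ≠ i₀ → c j ≠ 0 → q ∣ w j) :
    GradedWonBy 0 (n + 1) (sliceLattice (succLattice L w c) i₀) (sliceGerm i₀ g) → GradedWonBy 0 (n + 1 + 1) (succLattice L w c) g := by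
  intro hh
  have hfac' := subst_cruxChart_relabel_toLast i₀ w c F' a g hfac
  have h1 : GradedWonBy 0 (n + 1) (sliceLattice (succLattice (permLattice (toLast i₀) L) (fun j => w ((toLast i₀).symm j))
      (fun j => c ((toLast i₀).symm j))) (Fin.last n)) (sliceGerm (Fin.last n) (relabel (liftPerm (toLast i₀)) g)) := by
    rw [succLattice_relabel_toLast, sliceLattice_permLattice, sliceGerm_last_relabel, gradedWonBy_relabel_iff]
    exact hh
  have hmin' : ∀ j, j ≠ Fin.last n → (fun j => c ((toLast i₀).symm j)) j ≠ 0 → q ∣ (fun j => w ((toLast i₀).symm j)) j := by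
    intro j hj hcj
    refine hmin _ (fun h => hj ?_) hcj
    have := congrArg (toLast i₀) h
    rwa [Equiv.apply_symm_apply, toLast_self] at this
  have h2 := gradedWonBy_zero_of_slice_wild (fun j => w ((toLast i₀).symm j)) (fun j => c ((toLast i₀).symm j)) q
    (permLattice (toLast i₀) L) (relabel (toLast i₀) F') a _ hfac' (by simpa [toLast_symm_last] using hc)
    (by simpa [toLast_symm_last] using hw) p e hq (by simpa [toLast_symm_last] using hv) (by simpa [toLast_symm_last] using hE) hmin' h1
  rw [succLattice_relabel_toLast, gradedWonBy_relabel_iff] at h2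
  exact h2

end AnySlot

end GradedGame

end Summit.ResolutionOfSingularities.ResolutionOfSingularities.Theorems
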